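import Literature.NumberTheory.IwasawaTheory.ClassicalMuVanishesUnitNormIndexTrivialBase
import Literature.NumberTheory.IwasawaTheory.CyclotomicTwoTotallyRamifiedOddIndex
import HarnessLib

/-!
# The `p = 2` unit doors WITHOUT the generation hypothesis, for an odd-degree field of odd discriminant and ODD CLASS NUMBER:
# one (resp. two) explicit non-norm units at ONE layer `K_{n+1}/K_n` ⟹ `e_m` constant from that layer on, `μ₂ = 0`, `λ₂ = 0`

Topic `NumberTheory/IwasawaTheory` (namespace = path).  THEOREMS ONLY (no definition, no named fact, no instance, no `sorry`);
unconditional.  The `hgen`-free companion of `ClassicalMuVanishesOddDiscrUnitDoorsTwo.lean` (att-p3 g38): there the door at a layer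
`K_{n+1}/K_n` asked, besides the non-norm units of `K_n`, that the classes of the ramified primes generate `Cl(K_n)` modulo squares — a
displayed class-group datum.  By `ClassicalMuVanishesUnitNormIndexTrivialBase.lean` (this seat) that datum is superfluous as soon as
`2 ∤ h_K`: for a number field `K` of ODD DEGREE with `2 ∤ d_K` (so every cyclotomic `ℤ₂`-extension has Fukuda's index `0`,
`totallyRamifiedFrom_zero_of_not_dvd_discr`) and `2 ∤ h_K`, the inputs are ONLY: at most two (resp. three) primes of `K_n` ramified in
`K_{n+1}` and one unit `x` (resp. two units `x, y` with `x, y, xy`) of `K_n` outside `N K_{n+1}ˣ` — kernel-decidable dyadic residues at a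
prime ideal (`NumberFields/QuadraticNonNormUnitDyadicIdeal.lean`).  No class group of any layer `K_n`, `n ≥ 1`, is an input.

* `classNumberPExp_eq_of_le_two_of_nonNorm_unit_of_not_dvd_discr_of_not_dvd` / `…_of_two_nonNorm_units_…` — `e_m = e_n` for `m ≥ n`;
* `classicalMuVanishes_two_of_nonNorm_unit_of_not_dvd_discr_of_not_dvd` / `…_of_two_nonNorm_units_…` — `μ₂ = 0` (growth form) and
  `λ₂ = 0`.

USE (cell bsd-f1-sign2, crux C2, W-free): `K = F` a cubic field with `2 ∤ d_F` and `2 ∤ h_F`.  If `2 = 𝔭₁𝔭₂` in `F` (the cell's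
`Δ_W ≡ 5 (mod 8)` stratum) every layer pair has exactly two ramified primes and ONE non-norm unit of `F_n` suffices; if `2` splits
completely (`Δ_W ≡ 1 (mod 8)`) the `2`-class numbers grow strictly (Summits `…CubicTowerGrowth`) and the two-unit hypothesis is never met.
HONEST SCOPE: classical genus theory + Fukuda; nothing specific to any summit; BSD is not advanced by this file.

## References

* T. Fukuda, *Remarks on `ℤ_p`-extensions of number fields*, Proc. Japan Acad. 70 A (1994), Thm. 1 (1), p. 264. [Fukuda1994]
* L. C. Washington, *Introduction to Cyclotomic Fields*, 2nd ed., GTM 83 (1997), §13.1 Lemma 13.3, §13.3 Prop. 13.22. [Washington1997]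
* S. Lang, *Cyclotomic Fields I and II*, GTM 121 (1990), Ch. 13 §4, Lemma 4.1–4.2 and sequel. [Lang1990]
-/

noncomputable section

open NumberField IsDedekindDomain
open scoped nonZeroDivisors

namespace Literature.NumberTheory.IwasawaTheory

open Literature.NumberTheory.EllipticCurves Literature.NumberTheory.NumberFields
  Literature.NumberTheory.NumberFields.AmbiguousClass
  Literature.NumberTheory.GaloisRepresentations Literature.NumberTheory.GaloisRepresentations.Herbrand
  Literature.NumberTheory.GaloisRepresentations.MinkowskiUnit
  Literature.NumberTheory.GaloisRepresentations.CyclicNormIndex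

variable {K : Type} [Field K] [NumberField K] (κ : ZpExtension K 2) (n : ℕ) [NumberField (κ.layer n)]
  [Algebra (κ.layer n) (κ.layer (n + 1))] [IsScalarTower K (κ.layer n) (κ.layer (n + 1))]
  [FiniteDimensional K (κ.layer (n + 1))] [FiniteDimensional (κ.layer n) (κ.layer (n + 1))]

/-! ## §1 One non-norm unit (at most two ramified primes) -/

/-- **`e_m = e_n` for all `m ≥ n` from ONE non-norm unit of `K_n`** — `K` of odd degree, `2 ∤ d_K`, `2 ∤ h_K`, `κ` cyclotomic, a layer
`K_{n+1}/K_n` (a `K_n`-algebra compatibly with `K`) with at most two ramified primes and a unit `x` of `K_n` with `x ∉ N K_{n+1}ˣ`.  Fukuda's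
index is `0` (`totallyRamifiedFrom_zero_of_not_dvd_discr`); then `classNumberPExp_eq_of_le_two_of_nonNorm_unit_of_not_dvd` — no generation
hypothesis. [cite: Fukuda1994, Thm. 1 (1), p. 264] [cite: Washington1997, §13.1 Lemma 13.3 and §13.3 Prop. 13.22]
[cite: Lang1990, Ch. 13 §4, Lemma 4.1–4.2 and sequel] -/
theorem classNumberPExp_eq_of_le_two_of_nonNorm_unit_of_not_dvd_discr_of_not_dvd (hK2 : ¬ 2 ∣ Module.finrank ℚ K)
    (hd : ¬ (2 : ℤ) ∣ NumberField.discr K) (hK : ¬ 2 ∣ classNumber K) (hκ : κ.IsCyclotomic)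
    (hs : {w : HeightOneSpectrum (𝓞 (κ.layer n)) |
        w.asIdeal.ramificationIdxIn (𝓞 (κ.layer (n + 1))) ≠ 1}.ncard ≤ 2) {x : (κ.layer (n + 1))ˣ}
    (hxE : x ∈ unitsE (κ.layer (n + 1)) ⊓ (unitsIncl (κ.layer n) (κ.layer (n + 1))).range)
    (hxN : x ∉ (⊤ : Subgroup (κ.layer (n + 1))ˣ).map
        (Herbrand.norm (κ.layer (n + 1) ≃ₐ[κ.layer n] κ.layer (n + 1))))
    {m : ℕ} (hm : n ≤ m) : classNumberPExp κ m = classNumberPExp κ n :=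
  classNumberPExp_eq_of_le_two_of_nonNorm_unit_of_not_dvd κ n (totallyRamifiedFrom_zero_of_not_dvd_discr hK2 hd κ hκ) hK
    (Nat.zero_le n) hs hxE hxN hm

/-- **`μ₂ = 0` (growth form) and `λ₂ = 0` from ONE non-norm unit of `K_n`** — `K` of odd degree, `2 ∤ d_K`, `2 ∤ h_K`, `κ` cyclotomic,
at most two primes of `K_n` ramified in `K_{n+1}`, `x ∉ N K_{n+1}ˣ` a unit of `K_n`; no class group of any layer beyond `h_K`.
[cite: Fukuda1994, Thm. 1 (1), p. 264] [cite: Lang1990, Ch. 13 §4, Lemma 4.1–4.2 and sequel] -/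
theorem classicalMuVanishes_two_of_nonNorm_unit_of_not_dvd_discr_of_not_dvd (hK2 : ¬ 2 ∣ Module.finrank ℚ K)
    (hd : ¬ (2 : ℤ) ∣ NumberField.discr K) (hK : ¬ 2 ∣ classNumber K) (hκ : κ.IsCyclotomic)
    (hs : {w : HeightOneSpectrum (𝓞 (κ.layer n)) |
        w.asIdeal.ramificationIdxIn (𝓞 (κ.layer (n + 1))) ≠ 1}.ncard ≤ 2) {x : (κ.layer (n + 1))ˣ}
    (hxE : x ∈ unitsE (κ.layer (n + 1)) ⊓ (unitsIncl (κ.layer n) (κ.layer (n + 1))).range)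
    (hxN : x ∉ (⊤ : Subgroup (κ.layer (n + 1))ˣ).map
        (Herbrand.norm (κ.layer (n + 1) ≃ₐ[κ.layer n] κ.layer (n + 1)))) :
    ClassicalMuVanishes κ ∧ classicalLambda κ = 0 :=
  classicalMuVanishes_two_of_nonNorm_unit_of_not_dvd κ n (totallyRamifiedFrom_zero_of_not_dvd_discr hK2 hd κ hκ) hK
    (Nat.zero_le n) hs hxE hxN

/-! ## §2 Two independent non-norm units (at most three ramified primes) -/

/-- **`e_m = e_n` for all `m ≥ n` from TWO independent non-norm units of `K_n`** — `K` of odd degree, `2 ∤ d_K`, `2 ∤ h_K`, `κ`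
cyclotomic, a layer `K_{n+1}/K_n` with at most three ramified primes and units `x, y` of `K_n` with `x, y, xy ∉ N K_{n+1}ˣ`; no generation
hypothesis. [cite: Fukuda1994, Thm. 1 (1), p. 264] [cite: Washington1997, §13.1 Lemma 13.3 and §13.3 Prop. 13.22]
[cite: Lang1990, Ch. 13 §4, Lemma 4.1–4.2 and sequel] -/
theorem classNumberPExp_eq_of_le_two_of_two_nonNorm_units_of_not_dvd_discr_of_not_dvd (hK2 : ¬ 2 ∣ Module.finrank ℚ K)
    (hd : ¬ (2 : ℤ) ∣ NumberField.discr K) (hK : ¬ 2 ∣ classNumber K) (hκ : κ.IsCyclotomic)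
    (hs : {w : HeightOneSpectrum (𝓞 (κ.layer n)) |
        w.asIdeal.ramificationIdxIn (𝓞 (κ.layer (n + 1))) ≠ 1}.ncard ≤ 3) {x y : (κ.layer (n + 1))ˣ}
    (hxE : x ∈ unitsE (κ.layer (n + 1)) ⊓ (unitsIncl (κ.layer n) (κ.layer (n + 1))).range)
    (hyE : y ∈ unitsE (κ.layer (n + 1)) ⊓ (unitsIncl (κ.layer n) (κ.layer (n + 1))).range)
    (hxN : x ∉ (⊤ : Subgroup (κ.layer (n + 1))ˣ).map
        (Herbrand.norm (κ.layer (n + 1) ≃ₐ[κ.layer n] κ.layer (n + 1))))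
    (hyN : y ∉ (⊤ : Subgroup (κ.layer (n + 1))ˣ).map
        (Herbrand.norm (κ.layer (n + 1) ≃ₐ[κ.layer n] κ.layer (n + 1))))
    (hxyN : x * y ∉ (⊤ : Subgroup (κ.layer (n + 1))ˣ).map
        (Herbrand.norm (κ.layer (n + 1) ≃ₐ[κ.layer n] κ.layer (n + 1))))
    {m : ℕ} (hm : n ≤ m) : classNumberPExp κ m = classNumberPExp κ n :=
  classNumberPExp_eq_of_le_two_of_two_nonNorm_units_of_not_dvd κ n (totallyRamifiedFrom_zero_of_not_dvd_discr hK2 hd κ hκ)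
    hK (Nat.zero_le n) hs hxE hyE hxN hyN hxyN hm

/-- **`μ₂ = 0` (growth form) and `λ₂ = 0` from TWO independent non-norm units of `K_n`** — `K` of odd degree, `2 ∤ d_K`, `2 ∤ h_K`,
`κ` cyclotomic, at most three primes of `K_n` ramified in `K_{n+1}`, units `x, y` of `K_n` with `x, y, xy ∉ N K_{n+1}ˣ`; no class group of
any layer beyond `h_K`. [cite: Fukuda1994, Thm. 1 (1), p. 264] [cite: Lang1990, Ch. 13 §4, Lemma 4.1–4.2 and sequel] -/
theorem classicalMuVanishes_two_of_two_nonNorm_units_of_not_dvd_discr_of_not_dvd (hK2 : ¬ 2 ∣ Module.finrank ℚ K)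
    (hd : ¬ (2 : ℤ) ∣ NumberField.discr K) (hK : ¬ 2 ∣ classNumber K) (hκ : κ.IsCyclotomic)
    (hs : {w : HeightOneSpectrum (𝓞 (κ.layer n)) |
        w.asIdeal.ramificationIdxIn (𝓞 (κ.layer (n + 1))) ≠ 1}.ncard ≤ 3) {x y : (κ.layer (n + 1))ˣ}
    (hxE : x ∈ unitsE (κ.layer (n + 1)) ⊓ (unitsIncl (κ.layer n) (κ.layer (n + 1))).range)
    (hyE : y ∈ unitsE (κ.layer (n + 1)) ⊓ (unitsIncl (κ.layer n) (κ.layer (n + 1))).range)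
    (hxN : x ∉ (⊤ : Subgroup (κ.layer (n + 1))ˣ).map
        (Herbrand.norm (κ.layer (n + 1) ≃ₐ[κ.layer n] κ.layer (n + 1))))
    (hyN : y ∉ (⊤ : Subgroup (κ.layer (n + 1))ˣ).map
        (Herbrand.norm (κ.layer (n + 1) ≃ₐ[κ.layer n] κ.layer (n + 1))))
    (hxyN : x * y ∉ (⊤ : Subgroup (κ.layer (n + 1))ˣ).map
        (Herbrand.norm (κ.layer (n + 1) ≃ₐ[κ.layer n] κ.layer (n + 1)))) :
    ClassicalMuVanishes κ ∧ classicalLambda κ = 0 :=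
  classicalMuVanishes_two_of_two_nonNorm_units_of_not_dvd κ n (totallyRamifiedFrom_zero_of_not_dvd_discr hK2 hd κ hκ) hK
    (Nat.zero_le n) hs hxE hyE hxN hyN hxyN

end Literature.NumberTheory.IwasawaTheory

end
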